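import Summits.BirchSwinnertonDyer.Rank1Residual.P2.CMRankOneAtTwoHeegnerIndex
import HarnessLib

set_option linter.dupNamespace false -- namespace `…BirchSwinnertonDyer.BirchSwinnertonDyer…` is the cell's (D-0017 nested layout)
set_option autoImplicit false

/-!
# Route `GoldfeldAllTwistsTwoConverse`, crux twin″ `BSDTwoCMSevenAdditiveRankOne` (item 19140): PLACEMENT of
# the two halves of the registered line «heegner-halves» as the programme's TYPED halves at `2` on the cell

Seat `leafhand-bsd-goldfeldalltwistst-2-g0` (prover, explicit unit), `--supports stmt-BirchSwinnertonDyer-19140`.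
Theorems only; no definition, axiom, `sorry`, instance or notation; route-independent imports (rev 2: the
unused `Theses` import of rev 1 dropped, theses-cone hygiene). HONEST FRAMING: bookkeeping, not progress on
the crux — item 19140 (Miller's `BSD(W,2)` for globally minimal CM `W/ℚ`, `2` split in the CM field `ℚ(√−7)`,
ADDITIVE at `2`, analytic rank `1`) is research-open (Li–Tian–Yan–Zhu 2025 §1.3 (II); Burungale–Flach 2024
p. 6) and is NOT closed here; BSD is proved for no curve by this file.

The registered skeleton of the item (line «heegner-halves», `Cruxes/BSDTwoCMSevenAdditiveRankOne/Lines/`)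
splits the `L`-free identity `ord₂ 𝔮 = ord₂ #Ш(W)` of `P2.bsdp_two_iff_cmHeegnerIndex`
(`𝔮 = cmHeegnerIndexQuotient W K P c k Wd u`) into an UPPER half `ord₂ #Ш(W) ≤ ord₂ 𝔮`
(`stub_heegnerIndexUpperAtTwo`) and a LOWER half `ord₂ 𝔮 ≤ ord₂ #Ш(W)` (`stub_heegnerIndexLowerAtTwo`),
both quantified over every admissible Heegner datum of the cell and over the halvability value `k ∈ {1,2}`
pinned by its defining `iff`. The residual programme (cell `b2b-bsdres`, `Rank1Residual/Typed/Basic.lean`)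
types the same two directions in Miller's currency as `MissingUpperBoundAt W 2` ("Euler-system half":
`ord₂ #Ш ≤ ord₂ #Ш_an`) and `MissingLowerBoundAt W 2` ("main-conjecture half"), and the cell's file
`GoldfeldAllTwistsTwoConverseTwinGordPlacement` already transports THOSE, one half at a time, to the
auxiliary quadratic fields (`upperHalf_j_neg3375_additive_iff_forall_overC`, `lowerHalf_…`). This file closes
the square, half by half and in both directions, GRANTED the published binders of the P2 identity:

* §1 (pointwise, five binders `gross_zagier N W K`, `kolyvagin N W K`, GZK, `hasEntireLFunction_rat`,
  Burungale–Flach): for ONE CM rank-one datum, `MissingUpperBoundAt W 2` iff the upper `𝔮`-inequality holds for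
  every pinned `k`; likewise lower (`missingUpperBoundAt_two_iff_forall_heegnerIndexUpper`,
  `missingLowerBoundAt_two_iff_forall_heegnerIndexLower`) — `P2.missingHalves_two_iff_cmHeegnerIndex` with the
  halvability bit pinned.
* §2 (cell-wide, the EXACT shapes of the registered stubs): the typed upper half on the cell gives the body of
  `stub_heegnerIndexUpperAtTwo` (`heegnerIndexUpperAtTwo_of_missingUpperBoundAt`, five global binders) and
  conversely (`missingUpperBoundAt_of_heegnerIndexUpperAtTwo`, plus Waldspurger, parity and Heegner points for
  the datum); likewise lower. CONSEQUENCE for the line: modulo its third stub (the eight published binders),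
  each half-stub IS the corresponding typed half `MissingUpper/LowerBoundAt W 2` on the cell — so a ONE-SIDED
  theorem in either currency (a `2`-adic Kolyvagin bound, resp. a `2`-adic anticyclotomic divisibility / exact
  `2`-divisibility of the Heegner point), or over the auxiliary field via the Gord placement, closes exactly one
  stub. DIAGNOSIS recorded for the planner: the registered halves carry NO binder, so as registered each ALSO
  contains the Gross–Zagier non-degeneracy and Kolyvagin finiteness for its datum (without them the junk branches
  `P` torsion / `Ш(W)` infinite / `twinQuotient Wd = 0` are not excluded); the binder-carrying shapes of §2 are
  the honest-sized versions (proposed reshape `Lines/heegner_halves_v2.lean`).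

References: R. L. Miller, LMS J. Comput. Math. 14 (2011) Def. 1.1 [Miller2011LMS]; D. Burungale, M. Flach (2024)
Thm. 1.1, Cor. 2, p. 6 [BurungaleFlach2024]; B. Gross, D. Zagier, Invent. Math. 84 (1986) Thm. I.6.3
[GrossZagier1986]; Y.-X. Li, Y. Tian, X. Yan, X. Zhu, PAMQ 21 (2025) §1.3 [LiTianYanZhu2025].
-/

noncomputable section

open scoped Classical

open WeierstrassCurve NumberField Literature.NumberTheory.EllipticCurves
  Literature.NumberTheory.EllipticCurves.ModularForms
  Literature.NumberTheory.EllipticCurves.Rank1Residual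
  Literature.NumberTheory.EllipticCurves.Rank1Residual.Typed

namespace Summit.BirchSwinnertonDyer.BirchSwinnertonDyer.Theorems.GoldfeldGoodTwists

open Summit.BirchSwinnertonDyer.Rank1Residual Summit.BirchSwinnertonDyer.Rank1Residual.P2

/-! ## §1 Pointwise: the typed halves at `2` ⟺ the `𝔮`-inequalities for every pinned halvability value -/

/-- **Euler-system half, pointwise.** In the setting of `P2.bsdp_two_iff_cmHeegnerIndex` (globally minimal CM `W`
of analytic rank `1`, `K` imaginary quadratic with the Heegner hypothesis for `N`, `P` the Heegner point of
`(Dt, H, ι)`, rank-zero twin `L(W^{(d_K)},1) ≠ 0`, `Wd = Cd • W^{(d_K)}` globally minimal; Gross–Zagier, Kolyvagin,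
GZK, modularity and Burungale–Flach as binders): `MissingUpperBoundAt W 2` (`ord₂ #Ш(W) ≤ ord₂ #Ш_an(W)`) holds
iff `ord₂ #Ш(W) ≤ ord₂ 𝔮` for EVERY `k ∈ {1,2}` satisfying the halvability `iff` (there is exactly one).
[cite: Miller2011LMS, Def. 1.1] [cite: BurungaleFlach2024, Thm. 1.1 and Cor. 2] -/
theorem missingUpperBoundAt_two_iff_forall_heegnerIndexUpper
    (W : WeierstrassCurve ℚ) [W.IsElliptic] [W.IsGloballyMinimal]
    (N : ℕ) [NeZero N] (K : Type) [Field K] [NumberField K]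
    (Dt : ModularParametrizationData W N) (H : HeegnerDatum N (NumberField.discr K)) (ι : K →+* ℂ)
    (P : (W.baseChange K).toAffine.Point)
    (hGZ : gross_zagier N W K) (hKo : kolyvagin N W K)
    (hGZK : rank_eq_analyticRank_of_analyticRank_le_one) (hmod : hasEntireLFunction_rat)
    (hBF : bsdTriple_of_hasCM_of_L_one_ne_zero)
    (hcm : W.HasCM) (hK : IsImaginaryQuadratic K) (hHN : SatisfiesHeegnerHypothesis N K)
    (hP : WeierstrassCurve.Affine.Point.map ι.toRatAlgHom P = heegnerPointComplex Dt H)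
    (hr : W.analyticRank = 1)
    (hLt : (W.quadraticTwist (NumberField.discr K : ℚ)).entireLFunction 1 ≠ 0)
    (Wd : WeierstrassCurve ℚ) [Wd.IsElliptic] [Wd.IsGloballyMinimal] (Cd : VariableChange ℚ)
    (hWd : Cd • W.quadraticTwist (NumberField.discr K : ℚ) = Wd) :
    MissingUpperBoundAt W 2 ↔
      ∀ k : ℕ, (k = 1 ∨ k = 2) →
        (k = 2 ↔ ∀ y : W.toAffine.Point, ∃ Q : (W.baseChange K).toAffine.Point,
          QuadraticDescent.incl K W y - (2 : ℤ) • Q ∈ AddCommGroup.torsion (W.baseChange K).toAffine.Point) →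
        (padicValNat 2 (Nat.card W.sha) : ℤ) ≤ padicValRat 2 (cmHeegnerIndexQuotient W K P Dt.c k Wd Cd.u) := by
  obtain ⟨k', hk12', hkiff', -, hup⟩ := missingHalves_two_iff_cmHeegnerIndex W N K Dt H ι P hGZ hKo hGZK
    hmod hBF hcm hK hHN hP hr hLt Wd Cd hWd
  constructor
  · intro hU k hk12 hkiff
    -- the halvability bit pins `k`: `k = k'`
    have hkk : k = k' := by
      rcases hk12 with rfl | rfl <;> rcases hk12' with rfl | rfl
      · rfl
      · exact absurd (hkiff.mpr (hkiff'.mp rfl)) (by decide)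
      · exact absurd (hkiff'.mpr (hkiff.mp rfl)) (by decide)
      · rfl
    subst hkk
    exact hup.mp hU
  · intro h
    exact hup.mpr (h k' hk12' hkiff')

/-- **Main-conjecture half, pointwise.** Same setting: `MissingLowerBoundAt W 2` (`ord₂ #Ш_an(W) ≤ ord₂ #Ш(W)`)
holds iff `ord₂ 𝔮 ≤ ord₂ #Ш(W)` for every pinned `k ∈ {1,2}`. [cite: Miller2011LMS, Def. 1.1]
[cite: BurungaleFlach2024, Thm. 1.1 and Cor. 2] -/
theorem missingLowerBoundAt_two_iff_forall_heegnerIndexLower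
    (W : WeierstrassCurve ℚ) [W.IsElliptic] [W.IsGloballyMinimal]
    (N : ℕ) [NeZero N] (K : Type) [Field K] [NumberField K]
    (Dt : ModularParametrizationData W N) (H : HeegnerDatum N (NumberField.discr K)) (ι : K →+* ℂ)
    (P : (W.baseChange K).toAffine.Point)
    (hGZ : gross_zagier N W K) (hKo : kolyvagin N W K)
    (hGZK : rank_eq_analyticRank_of_analyticRank_le_one) (hmod : hasEntireLFunction_rat)
    (hBF : bsdTriple_of_hasCM_of_L_one_ne_zero)
    (hcm : W.HasCM) (hK : IsImaginaryQuadratic K) (hHN : SatisfiesHeegnerHypothesis N K)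
    (hP : WeierstrassCurve.Affine.Point.map ι.toRatAlgHom P = heegnerPointComplex Dt H)
    (hr : W.analyticRank = 1)
    (hLt : (W.quadraticTwist (NumberField.discr K : ℚ)).entireLFunction 1 ≠ 0)
    (Wd : WeierstrassCurve ℚ) [Wd.IsElliptic] [Wd.IsGloballyMinimal] (Cd : VariableChange ℚ)
    (hWd : Cd • W.quadraticTwist (NumberField.discr K : ℚ) = Wd) :
    MissingLowerBoundAt W 2 ↔
      ∀ k : ℕ, (k = 1 ∨ k = 2) →
        (k = 2 ↔ ∀ y : W.toAffine.Point, ∃ Q : (W.baseChange K).toAffine.Point,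
          QuadraticDescent.incl K W y - (2 : ℤ) • Q ∈ AddCommGroup.torsion (W.baseChange K).toAffine.Point) →
        padicValRat 2 (cmHeegnerIndexQuotient W K P Dt.c k Wd Cd.u) ≤ padicValNat 2 (Nat.card W.sha) := by
  obtain ⟨k', hk12', hkiff', hlow, -⟩ := missingHalves_two_iff_cmHeegnerIndex W N K Dt H ι P hGZ hKo hGZK
    hmod hBF hcm hK hHN hP hr hLt Wd Cd hWd
  constructor
  · intro hL k hk12 hkiff
    -- the halvability bit pins `k`: `k = k'`
    have hkk : k = k' := by
      rcases hk12 with rfl | rfl <;> rcases hk12' with rfl | rfl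
      · rfl
      · exact absurd (hkiff.mpr (hkiff'.mp rfl)) (by decide)
      · exact absurd (hkiff'.mpr (hkiff.mp rfl)) (by decide)
      · rfl
    subst hkk
    exact hlow.mp hL
  · intro h
    exact hlow.mpr (h k' hk12' hkiff')

/-! ## §2 Cell-wide, in the exact shapes of the registered stubs -/

/-- **The typed Euler-system half on the cell gives the body of `stub_heegnerIndexUpperAtTwo`** (granted the
five published binders of `P2.bsdp_two_iff_cmHeegnerIndex`, cell-wide): if `MissingUpperBoundAt W 2` holds for
every globally minimal CM `W` with `CMSplit W 2`, additive at `2`, of analytic rank `1`, then for every admissible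
Heegner datum of such a `W` and every pinned `k`, `ord₂ #Ш(W) ≤ ord₂ 𝔮`. [cite: Miller2011LMS, Def. 1.1]
[cite: BurungaleFlach2024, Thm. 1.1 and Cor. 2] -/
theorem heegnerIndexUpperAtTwo_of_missingUpperBoundAt
    (hGZ : ∀ (N : ℕ) [NeZero N] (W : WeierstrassCurve ℚ) (K : Type) [Field K] [NumberField K],
      gross_zagier N W K)
    (hKo : ∀ (N : ℕ) [NeZero N] (W : WeierstrassCurve ℚ) (K : Type) [Field K] [NumberField K],
      kolyvagin N W K)
    (hGZK : rank_eq_analyticRank_of_analyticRank_le_one) (hmod : hasEntireLFunction_rat)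
    (hBF : bsdTriple_of_hasCM_of_L_one_ne_zero)
    (hU : ∀ (W : WeierstrassCurve ℚ) [W.IsElliptic] [W.IsGloballyMinimal], W.HasCM → CMSplit W 2 →
      ¬ W.HasGoodReductionAtPrime 2 → W.analyticRank = 1 → MissingUpperBoundAt W 2) :
    ∀ (W : WeierstrassCurve ℚ) [W.IsElliptic] [W.IsGloballyMinimal] (N : ℕ) [NeZero N] (K : Type) [Field K]
      [NumberField K] (Dt : ModularParametrizationData W N) (H : HeegnerDatum N (NumberField.discr K))
      (ι : K →+* ℂ) (P : (W.baseChange K).toAffine.Point) (Wd : WeierstrassCurve ℚ) [Wd.IsElliptic]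
      [Wd.IsGloballyMinimal] (Cd : VariableChange ℚ) (k : ℕ), W.HasCM → CMSplit W 2 →
      ¬ W.HasGoodReductionAtPrime 2 → W.analyticRank = 1 → IsImaginaryQuadratic K →
      SatisfiesHeegnerHypothesis N K →
      WeierstrassCurve.Affine.Point.map ι.toRatAlgHom P = heegnerPointComplex Dt H →
      (W.quadraticTwist (NumberField.discr K : ℚ)).entireLFunction 1 ≠ 0 →
      Cd • W.quadraticTwist (NumberField.discr K : ℚ) = Wd → (k = 1 ∨ k = 2) →
      (k = 2 ↔ ∀ y : W.toAffine.Point, ∃ Q : (W.baseChange K).toAffine.Point,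
        QuadraticDescent.incl K W y - (2 : ℤ) • Q ∈ AddCommGroup.torsion (W.baseChange K).toAffine.Point) →
      (padicValNat 2 (Nat.card W.sha) : ℤ) ≤ padicValRat 2 (cmHeegnerIndexQuotient W K P Dt.c k Wd Cd.u) := by
  intro W _ _ N _ K _ _ Dt H ι P Wd _ _ Cd k hcm hsplit hbad hr hK hHN hP hLt hWd hk12 hkiff
  exact (missingUpperBoundAt_two_iff_forall_heegnerIndexUpper W N K Dt H ι P (hGZ N W K) (hKo N W K) hGZK
    hmod hBF hcm hK hHN hP hr hLt Wd Cd hWd).mp (hU W hcm hsplit hbad hr) k hk12 hkiff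

/-- **Conversely, the body of `stub_heegnerIndexUpperAtTwo` gives the typed Euler-system half on the cell**
(granted, in addition, Waldspurger's Heegner field with rank-zero twin `hWa`, parity `hpar` and Heegner points
`hHP`, which produce an admissible datum for every `W` of the cell: `r_an = 1` odd ⇒ `w(W) = −1` ⇒ a Heegner
field `K'` for `N_W` with `L(W^{(d_{K'})},1) ≠ 0`, a Heegner point over it and a minimal model of the twist).
[cite: GrossZagier1986, I.§4 and Thm. I.6.3] [cite: Miller2011LMS, Def. 1.1] -/
theorem missingUpperBoundAt_of_heegnerIndexUpperAtTwo
    (hGZ : ∀ (N : ℕ) [NeZero N] (W : WeierstrassCurve ℚ) (K : Type) [Field K] [NumberField K],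
      gross_zagier N W K)
    (hKo : ∀ (N : ℕ) [NeZero N] (W : WeierstrassCurve ℚ) (K : Type) [Field K] [NumberField K],
      kolyvagin N W K)
    (hGZK : rank_eq_analyticRank_of_analyticRank_le_one) (hmod : hasEntireLFunction_rat)
    (hBF : bsdTriple_of_hasCM_of_L_one_ne_zero)
    (hWa : waldspurger_exists_heegnerField_twist_ne_zero)
    (hpar : ∀ W : WeierstrassCurve ℚ, W.even_analyticRank_iff)
    (hHP : ∀ (W : WeierstrassCurve ℚ) (K : Type) [Field K] [NumberField K], exists_isHeegnerPoint W K)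
    (h : ∀ (W : WeierstrassCurve ℚ) [W.IsElliptic] [W.IsGloballyMinimal] (N : ℕ) [NeZero N] (K : Type) [Field K]
      [NumberField K] (Dt : ModularParametrizationData W N) (H : HeegnerDatum N (NumberField.discr K))
      (ι : K →+* ℂ) (P : (W.baseChange K).toAffine.Point) (Wd : WeierstrassCurve ℚ) [Wd.IsElliptic]
      [Wd.IsGloballyMinimal] (Cd : VariableChange ℚ) (k : ℕ), W.HasCM → CMSplit W 2 →
      ¬ W.HasGoodReductionAtPrime 2 → W.analyticRank = 1 → IsImaginaryQuadratic K →
      SatisfiesHeegnerHypothesis N K →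
      WeierstrassCurve.Affine.Point.map ι.toRatAlgHom P = heegnerPointComplex Dt H →
      (W.quadraticTwist (NumberField.discr K : ℚ)).entireLFunction 1 ≠ 0 →
      Cd • W.quadraticTwist (NumberField.discr K : ℚ) = Wd → (k = 1 ∨ k = 2) →
      (k = 2 ↔ ∀ y : W.toAffine.Point, ∃ Q : (W.baseChange K).toAffine.Point,
        QuadraticDescent.incl K W y - (2 : ℤ) • Q ∈ AddCommGroup.torsion (W.baseChange K).toAffine.Point) →
      (padicValNat 2 (Nat.card W.sha) : ℤ) ≤ padicValRat 2 (cmHeegnerIndexQuotient W K P Dt.c k Wd Cd.u)) :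
    ∀ (W : WeierstrassCurve ℚ) [W.IsElliptic] [W.IsGloballyMinimal], W.HasCM → CMSplit W 2 →
      ¬ W.HasGoodReductionAtPrime 2 → W.analyticRank = 1 → MissingUpperBoundAt W 2 := by
  intro W _ _ hcm hsplit hbad hr
  -- the sign: `r_an = 1` is odd, so `w(W) = -1`
  have hw : W.rootNumber = -1 := by
    rcases W.rootNumber_eq_one_or with hw | hw
    · exact absurd ((hpar W).mpr hw) (by rw [hr]; exact Nat.not_even_one)
    · exact hw
  -- Waldspurger: a Heegner field `K'` for `N_W` with rank-zero twin
  obtain ⟨K, _, _, hKq, hH, hLt⟩ := hWa.exists W hw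
  haveI : NeZero (W.conductorNorm ℤ) := ⟨(W.conductorNorm_pos_holds).ne'⟩
  -- a Heegner point over `K'`
  obtain ⟨P, Dt, Hg, ι, hP⟩ := hHP W K hKq hH
  -- a globally minimal model of the twin
  have hd : (NumberField.discr K : ℚ) ≠ 0 := by exact_mod_cast NumberField.discr_ne_zero K
  haveI := W.isElliptic_quadraticTwist hd
  obtain ⟨Cd, hCd⟩ := hasGlobalMinimalModel_rat_holds (W.quadraticTwist (NumberField.discr K : ℚ))
  haveI := hCd
  exact (missingUpperBoundAt_two_iff_forall_heegnerIndexUpper W (W.conductorNorm ℤ) K Dt Hg ι P (hGZ _ W K)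
    (hKo _ W K) hGZK hmod hBF hcm hKq hH hP hr hLt (Cd • W.quadraticTwist (NumberField.discr K : ℚ)) Cd
    rfl).mpr
    (fun k hk12 hkiff => h W (W.conductorNorm ℤ) K Dt Hg ι P _ Cd k hcm hsplit hbad hr hKq hH hP hLt rfl
      hk12 hkiff)

/-- **The typed main-conjecture half on the cell gives the body of `stub_heegnerIndexLowerAtTwo`** (five global
binders): if `MissingLowerBoundAt W 2` holds on the cell, then `ord₂ 𝔮 ≤ ord₂ #Ш(W)` for every admissible datum
and every pinned `k`. [cite: Miller2011LMS, Def. 1.1] [cite: BurungaleFlach2024, Thm. 1.1 and Cor. 2] -/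
theorem heegnerIndexLowerAtTwo_of_missingLowerBoundAt
    (hGZ : ∀ (N : ℕ) [NeZero N] (W : WeierstrassCurve ℚ) (K : Type) [Field K] [NumberField K],
      gross_zagier N W K)
    (hKo : ∀ (N : ℕ) [NeZero N] (W : WeierstrassCurve ℚ) (K : Type) [Field K] [NumberField K],
      kolyvagin N W K)
    (hGZK : rank_eq_analyticRank_of_analyticRank_le_one) (hmod : hasEntireLFunction_rat)
    (hBF : bsdTriple_of_hasCM_of_L_one_ne_zero)
    (hL : ∀ (W : WeierstrassCurve ℚ) [W.IsElliptic] [W.IsGloballyMinimal], W.HasCM → CMSplit W 2 →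
      ¬ W.HasGoodReductionAtPrime 2 → W.analyticRank = 1 → MissingLowerBoundAt W 2) :
    ∀ (W : WeierstrassCurve ℚ) [W.IsElliptic] [W.IsGloballyMinimal] (N : ℕ) [NeZero N] (K : Type) [Field K]
      [NumberField K] (Dt : ModularParametrizationData W N) (H : HeegnerDatum N (NumberField.discr K))
      (ι : K →+* ℂ) (P : (W.baseChange K).toAffine.Point) (Wd : WeierstrassCurve ℚ) [Wd.IsElliptic]
      [Wd.IsGloballyMinimal] (Cd : VariableChange ℚ) (k : ℕ), W.HasCM → CMSplit W 2 →
      ¬ W.HasGoodReductionAtPrime 2 → W.analyticRank = 1 → IsImaginaryQuadratic K →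
      SatisfiesHeegnerHypothesis N K →
      WeierstrassCurve.Affine.Point.map ι.toRatAlgHom P = heegnerPointComplex Dt H →
      (W.quadraticTwist (NumberField.discr K : ℚ)).entireLFunction 1 ≠ 0 →
      Cd • W.quadraticTwist (NumberField.discr K : ℚ) = Wd → (k = 1 ∨ k = 2) →
      (k = 2 ↔ ∀ y : W.toAffine.Point, ∃ Q : (W.baseChange K).toAffine.Point,
        QuadraticDescent.incl K W y - (2 : ℤ) • Q ∈ AddCommGroup.torsion (W.baseChange K).toAffine.Point) →
      padicValRat 2 (cmHeegnerIndexQuotient W K P Dt.c k Wd Cd.u) ≤ padicValNat 2 (Nat.card W.sha) := by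
  intro W _ _ N _ K _ _ Dt H ι P Wd _ _ Cd k hcm hsplit hbad hr hK hHN hP hLt hWd hk12 hkiff
  exact (missingLowerBoundAt_two_iff_forall_heegnerIndexLower W N K Dt H ι P (hGZ N W K) (hKo N W K) hGZK
    hmod hBF hcm hK hHN hP hr hLt Wd Cd hWd).mp (hL W hcm hsplit hbad hr) k hk12 hkiff

/-- **Conversely, the body of `stub_heegnerIndexLowerAtTwo` gives the typed main-conjecture half on the cell**
(eight binders, as for the upper half). [cite: GrossZagier1986, I.§4 and Thm. I.6.3] [cite: Miller2011LMS, Def. 1.1] -/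
theorem missingLowerBoundAt_of_heegnerIndexLowerAtTwo
    (hGZ : ∀ (N : ℕ) [NeZero N] (W : WeierstrassCurve ℚ) (K : Type) [Field K] [NumberField K],
      gross_zagier N W K)
    (hKo : ∀ (N : ℕ) [NeZero N] (W : WeierstrassCurve ℚ) (K : Type) [Field K] [NumberField K],
      kolyvagin N W K)
    (hGZK : rank_eq_analyticRank_of_analyticRank_le_one) (hmod : hasEntireLFunction_rat)
    (hBF : bsdTriple_of_hasCM_of_L_one_ne_zero)
    (hWa : waldspurger_exists_heegnerField_twist_ne_zero)
    (hpar : ∀ W : WeierstrassCurve ℚ, W.even_analyticRank_iff)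
    (hHP : ∀ (W : WeierstrassCurve ℚ) (K : Type) [Field K] [NumberField K], exists_isHeegnerPoint W K)
    (h : ∀ (W : WeierstrassCurve ℚ) [W.IsElliptic] [W.IsGloballyMinimal] (N : ℕ) [NeZero N] (K : Type) [Field K]
      [NumberField K] (Dt : ModularParametrizationData W N) (H : HeegnerDatum N (NumberField.discr K))
      (ι : K →+* ℂ) (P : (W.baseChange K).toAffine.Point) (Wd : WeierstrassCurve ℚ) [Wd.IsElliptic]
      [Wd.IsGloballyMinimal] (Cd : VariableChange ℚ) (k : ℕ), W.HasCM → CMSplit W 2 →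
      ¬ W.HasGoodReductionAtPrime 2 → W.analyticRank = 1 → IsImaginaryQuadratic K →
      SatisfiesHeegnerHypothesis N K →
      WeierstrassCurve.Affine.Point.map ι.toRatAlgHom P = heegnerPointComplex Dt H →
      (W.quadraticTwist (NumberField.discr K : ℚ)).entireLFunction 1 ≠ 0 →
      Cd • W.quadraticTwist (NumberField.discr K : ℚ) = Wd → (k = 1 ∨ k = 2) →
      (k = 2 ↔ ∀ y : W.toAffine.Point, ∃ Q : (W.baseChange K).toAffine.Point,
        QuadraticDescent.incl K W y - (2 : ℤ) • Q ∈ AddCommGroup.torsion (W.baseChange K).toAffine.Point) →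
      padicValRat 2 (cmHeegnerIndexQuotient W K P Dt.c k Wd Cd.u) ≤ padicValNat 2 (Nat.card W.sha)) :
    ∀ (W : WeierstrassCurve ℚ) [W.IsElliptic] [W.IsGloballyMinimal], W.HasCM → CMSplit W 2 →
      ¬ W.HasGoodReductionAtPrime 2 → W.analyticRank = 1 → MissingLowerBoundAt W 2 := by
  intro W _ _ hcm hsplit hbad hr
  -- the sign: `r_an = 1` is odd, so `w(W) = -1`
  have hw : W.rootNumber = -1 := by
    rcases W.rootNumber_eq_one_or with hw | hw
    · exact absurd ((hpar W).mpr hw) (by rw [hr]; exact Nat.not_even_one)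
    · exact hw
  -- Waldspurger: a Heegner field `K'` for `N_W` with rank-zero twin
  obtain ⟨K, _, _, hKq, hH, hLt⟩ := hWa.exists W hw
  haveI : NeZero (W.conductorNorm ℤ) := ⟨(W.conductorNorm_pos_holds).ne'⟩
  -- a Heegner point over `K'`
  obtain ⟨P, Dt, Hg, ι, hP⟩ := hHP W K hKq hH
  -- a globally minimal model of the twin
  have hd : (NumberField.discr K : ℚ) ≠ 0 := by exact_mod_cast NumberField.discr_ne_zero K
  haveI := W.isElliptic_quadraticTwist hd
  obtain ⟨Cd, hCd⟩ := hasGlobalMinimalModel_rat_holds (W.quadraticTwist (NumberField.discr K : ℚ))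
  haveI := hCd
  exact (missingLowerBoundAt_two_iff_forall_heegnerIndexLower W (W.conductorNorm ℤ) K Dt Hg ι P (hGZ _ W K)
    (hKo _ W K) hGZK hmod hBF hcm hKq hH hP hr hLt (Cd • W.quadraticTwist (NumberField.discr K : ℚ)) Cd
    rfl).mpr
    (fun k hk12 hkiff => h W (W.conductorNorm ℤ) K Dt Hg ι P _ Cd k hcm hsplit hbad hr hKq hH hP hLt rfl
      hk12 hkiff)

end Summit.BirchSwinnertonDyer.BirchSwinnertonDyer.Theorems.GoldfeldGoodTwists

end
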